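import Summits.KontsevichZagierPeriods.KontsevichZagierPeriods.Theorems.RootDecompRelativeModAbsoluteRegKernelPairLeOneP11X
import Summits.KontsevichZagierPeriods.KontsevichZagierPeriods.Theorems.RootDecompRelativeModAbsoluteRegFoldingDegOneP13

/-!
(LANDED by the census seat decomp-kz-census-1 g7 `--supports stmt-KontsevichZagierPeriods-30572`; source lens-3 g9 landing package #2 / CylKernelZero Inline fallback, critic decomp-kz-crit-1 g2 CLEARED §14–§19; generic docstrings added where the source had none.)

# `RegKernelPairDegOne`, the COMMON-`κ₀ > 0` case with BOTH KINDS (route `RootDecompRelativeModAbsolute`,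
support item stmt-KontsevichZagierPeriods-30572) — PROVED · part 12 (the rung theorem)

Cell `decomp-kz`, lens 3 (decomp-kz-lens-3 g9), §18 of the HOME file.  Item 30572 for ANY numbers `k, k'` of
regularised monomials of EITHER kind (`eᵢ, e'ⱼ ∈ {1,2}` free per monomial) sharing ONE argument function
`κ₀ > 0` (`κᵢ = κ'ⱼ = κ₀`, `ℚ`-semialgebraic on `G ∪ G'`).  The fibre numbers obey `ℓ_{2j+1,2}(κ) = ℓ_{j,1}(κ)/2`,
so this rung needs ONE genuine change of variables (Kontsevich–Zagier rule (2), tree generator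
`KZ.changeOfVariablesRel`): the fibrewise squaring `(x,θ) ↦ (x,θ²)` on the OPEN cylinder, turning odd
arctan-kind monomials into log-kind ones; Baker (mixed form) then kills the log-kind and the even-arctan-kind
remainders.  This part: the two-kind regrouping `sum_regroup₂` and the rung theorem `regKernelPairDegOne_of_commonPos` = the route item VERBATIM plus the extra hypotheses (`κ₀`, `ℚ`-semialgebraic with `κ₀ > 0` on `G ∪ G'`, `κᵢ = κ'ⱼ = κ₀`): collapse each side to ONE representation, split the bases into `G ∩ G'`, `G ∖ G'`, `G' ∖ G`, subtract on the common piece and apply the mixed core lemma of part 11 to the three pieces.  (`κ₀ ≤ 0` with arctan-kind monomials is NOT covered: on cells with constant `κ₀ = −u²` and multiplicatively dependent `1 ± u` the remainders need not vanish.)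

Source: `HOME/decomp-kz-lens-3/g9/RelativeModAbsoluteDegOneBands.lean` §18 (v6 sha256 720470ba3a4f13d9, 8617 l;
farm rc 0 / 0 warn / 0 sorry; `#print axioms regKernelPairDegOne_of_commonPos` = propext, Classical.choice,
Quot.sound), extracted verbatim into the namespace of the landed chain.  No `sorry`; standard axioms.
References: Baker 1975 Thm 2.1 [tree: `baker_holds`]; [cite: KontsevichZagier2001, §1.2]; Bochnak–Coste–Roy 1998 §2.9.
-/

noncomputable section

open Set MeasureTheory Filter Topology
open scoped BigOperators
open Literature.NumberTheory.Transcendental Literature.ModelTheory.ExponentialFields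

namespace Summit.KontsevichZagierPeriods.RootDecompRelativeModAbsolute.Rung30571

namespace RegularisedLogLayer

/-- (PRIVATE copy — the chain module RegFoldingDegOneP05 keeps this lemma private because its landed twin lives in a farm-unbuilt HyperbolicBloch module.) Finite sums of `ℚ`-semialgebraic functions are `ℚ`-semialgebraic. [BCR 1998, Prop. 2.2.6] -/
private theorem isSemialgebraicFunOn_finset_sum {n : ℕ} {s : Set (Fin n → ℝ)} (hs : IsSemialgebraic ℚ s)
    {ι : Type*} (I : Finset ι) {f : ι → (Fin n → ℝ) → ℝ}
    (hf : ∀ i ∈ I, IsSemialgebraicFunOn ℚ s (f i)) :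
    IsSemialgebraicFunOn ℚ s (fun x => ∑ i ∈ I, f i x) := by
  classical
  induction I using Finset.induction_on with
  | empty => exact (isSemialgebraicFunOn_ratCast hs 0).congr fun x _ => by simp
  | insert a I ha ih =>
    have h1 : IsSemialgebraicFunOn ℚ s (f a) := hf a (Finset.mem_insert_self a I)
    have h2 := ih fun i hi => hf i (Finset.mem_insert_of_mem hi)
    refine (IsSemialgebraicFunOn.add_holds h1 h2).congr fun x _ => ?_
    simp only [Pi.add_apply, Finset.sum_insert ha]

section CommonPosRung

/-- Two-kind regrouping of a monomial sum by (order, kind). -/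
theorem sum_regroup₂ {k : ℕ} (M e : Fin k → ℕ) (u : Fin k → ℝ) (φ : ℕ → ℕ → ℝ) {n₁ n₂ : ℕ}
    (hM₁ : ∀ i, M i ≤ n₁) (hM₂ : ∀ i, M i ≤ n₂) (he : ∀ i, e i = 1 ∨ e i = 2) :
    ∑ i, u i * φ (M i) (e i) =
      ∑ m ∈ Finset.range (n₁ + 1),
          (∑ i, if M i = m then (if e i = 1 then u i else 0) else 0) * φ m 1 +
        ∑ m ∈ Finset.range (n₂ + 1),
          (∑ i, if M i = m then (if e i = 2 then u i else 0) else 0) * φ m 2 := by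
  classical
  have h1 : ∀ i, u i * φ (M i) (e i) =
      (if e i = 1 then u i else 0) * φ (M i) 1 + (if e i = 2 then u i else 0) * φ (M i) 2 := by
    intro i
    rcases he i with h | h
    · simp [h]
    · simp [h]
  rw [Finset.sum_congr rfl (fun i _ => h1 i), Finset.sum_add_distrib,
    sum_regroup M (fun i => if e i = 1 then u i else 0) (fun m => φ m 1) hM₁,
    sum_regroup M (fun i => if e i = 2 then u i else 0) (fun m => φ m 2) hM₂]

end CommonPosRung

end RegularisedLogLayer

end Summit.KontsevichZagierPeriods.RootDecompRelativeModAbsolute.Rung30571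

end
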